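import Summits.QuantumFields.YangMills.Theorems.BalabanLadderIRTwistedSlabCovariantCalculus
import HarnessLib

/-!
# The discrete Weitzenböck identity on the `Fin` box `Σ_{μ<ν} S(curl a) + S(div a) = Σ_{μ,ν} S(∇⁺a)` and the Coulomb-gauge
# transfer of a 0-form gap to lattice 1-forms

HELPER toward stub **T1** `TwistedSlabAnchor` (LINE `twisted-slab-continuity`, crux `IRcof` stmt-QuantumFields-26930, census row 43;
LEAD prover ym-ir-line-tsc-p1 g3; `--supports` the crux, `--as helper`).  Second file of the HOME HANDOFF item K3 («transversal
non-degeneracy of the classical vacua IN T1's OWN CURRENCY»), sequel of `…TwistedSlabCovariantCalculus` (covariant shifts `S_μ`,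
adjoints `S_μ†`, differences `∇⁺_μ = S_μ − 1`, divergence `div a = Σ_μ (S_μ† a_μ − a_μ)`, commutation at a PHASE-FLAT unitary background).
* `sum_hsRe_cross`: the cross term `Σ_x Re tr((∇⁺_μ a_ν)ᴴ(∇⁺_ν a_μ)) = Σ_x Re tr((S_μ†a_μ − a_μ)ᴴ(S_ν†a_ν − a_ν))` (adjointness twice + `(H)`);
* ★★ `weitzenboeck_finBox`: for every lattice 1-form `a : Fin 4 → FinTorusSite → M_N(ℂ)` at a phase-flat unitary background,
  `Σ_x Σ_μ Σ_ν S(∇⁺_μ a_ν − ∇⁺_ν a_μ)(x) + 2·Σ_x S(div a)(x) = 2·Σ_x Σ_μ Σ_ν S(∇⁺_μ a_ν)(x)` (`S(X) = Re tr(XᴴX)`) — the concrete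
  `Fin`-box instance of lit-4's abstract `Literature.Analysis.OperatorTheory.DiscreteWeitzenboeck.half_sum_curl_sq_add_div_sq`
  (quadratic Wilson action + Feynman-gauge term = componentwise covariant Laplacian form);
* `sum_pairs_lt_eq_half` ∕ `sum_hsS_curl_pairs`: conversion to the ordered-pair sum `Σ_{q : μ<ν}` of the integrand of
  `wilsonFinTorusTensorTwistedPartition`;
* ★★ `coulomb_gap_of_zeroForm_gap`: a 0-form gap `m·Σ_x S(Φ x) ≤ Σ_x Σ_μ S(∇⁺_μ Φ)(x)` for TRACELESS `Φ` transfers to the Coulomb slice: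
  `m·Σ_x Σ_ν S(a_ν x) ≤ Σ_x Σ_{μ<ν} S(∇⁺_μ a_ν − ∇⁺_ν a_μ)(x)` for traceless `a` with `div a = 0` (the `Fin`-box instance of
  `DiscreteWeitzenboeck.gap_of_div_eq_zero`).
* §5 `ladderField Γ` — the matrix-level ladder (`Γ μ` on the sheet `x_μ = 0`, `1` elsewhere; `= ladderConfig` of `…TwistedSlabGauge` coerced,
  `ladderField_eq_coe_ladderConfig`); unitary if `Γ` is (`ladderField_mem_unitaryGroup`); PHASE-FLAT if the `Γ μ` commute up to phases
  (`isPhaseFlat_ladderField`), in particular the decorated twist eaters `![A, B, c₂·1, c₃·1]` of a Weyl pair `AB = ω·BA`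
  (`isPhaseFlat_ladderField_pair`) — the classical vacua of `…TwistedSlabVacuumOrbits`.
The 0-form input at the twist-eating ladder (`m = 4 sin²(π/(Nℓ₀))`, from lit-4's `twistedTorus_poincare_sharp`) and the identification of
the curl form with the second variation of the T1 integrand's exponent are the next files (`…TwistedSlabZeroFormGap`, `…TwistedSlabHessian`).

HONEST FRAMING: finite-dimensional operator algebra on one box — TREE LEVEL; nothing here is an estimate on the Wilson measure,
nothing uniform in `β`; T1-box 0∕1, T1 proper (uniform exponential vacuum dominance) 0∕1; nothing bears on `IRcof`, `IR`, or the
Yang–Mills mass gap (Clay: NOT proved); R4 = `BalabanLadder.UV` only.  References: M. García Pérez, A. González-Arroyo, M. Okawa,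
JHEP 10 (2017) 150 §2.2, §2.3, §2.5; the same, IJMPA 29 (2014) 1445001 §3 (Feynman gauge on the twisted box).
-/

set_option autoImplicit false

noncomputable section

open scoped Matrix
open Finset
open Literature.MathematicalPhysics.QuantumFieldTheory Literature.MathematicalPhysics.QuantumLattice

namespace Summit.QuantumFields.YangMills.Cruxes.IRcof.TwistedSlab

variable {N : ℕ} {n₀ n₁ n₂ n₃ : ℕ}

/-- Symmetry `Re tr(XᴴY) = Re tr(YᴴX)`. [folklore] -/
private theorem hsRe_symm (X Y : Matrix (Fin N) (Fin N) ℂ) : ((Xᴴ * Y).trace).re = ((Yᴴ * X).trace).re := by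
  have h : Yᴴ * X = (Xᴴ * Y)ᴴ := by rw [Matrix.conjTranspose_mul, Matrix.conjTranspose_conjTranspose]
  rw [h, Matrix.trace_conjTranspose, Complex.star_def, Complex.conj_re]

/-! ## §4 The discrete Weitzenböck identity on the `Fin` box and the Coulomb-gauge transfer of a 0-form gap -/

section Weitzenboeck

variable {U : FinTorusSite n₀ n₁ n₂ n₃ × Fin 4 → Matrix (Fin N) (Fin N) ℂ}

/-- The cross term: `Σ_x Re tr((∇⁺_μ a_ν)ᴴ (∇⁺_ν a_μ)) = Σ_x Re tr((S_μ†a_μ − a_μ)ᴴ (S_ν†a_ν − a_ν))` at a phase-flat unitary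
background (adjointness twice and `(H)`). [folklore] -/
theorem sum_hsRe_cross (hU : ∀ e, U e ∈ Matrix.unitaryGroup (Fin N) ℂ) (hflat : IsPhaseFlat U) (μ ν : Fin 4)
    (a : Fin 4 → FinTorusSite n₀ n₁ n₂ n₃ → Matrix (Fin N) (Fin N) ℂ) :
    ∑ x, (((covDeriv U μ (a ν) x)ᴴ * covDeriv U ν (a μ) x).trace).re =
      ∑ x, (((covShiftAdj U μ (a μ) x - a μ x)ᴴ * (covShiftAdj U ν (a ν) x - a ν x)).trace).re := by
  -- move `∇⁺_μ` to the right factor as `S_μ† − 1`, commute with `S_ν† − 1`, move `∇⁺_ν` back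
  have h1 : ∑ x, (((covShiftAdj U μ (a μ) x - a μ x)ᴴ * (covShiftAdj U ν (a ν) x - a ν x)).trace).re =
      ∑ x, (((a μ x)ᴴ * covDeriv U μ (fun y => covShiftAdj U ν (a ν) y - a ν y) x).trace).re :=
    sum_hsRe_covDerivAdj hU μ (a μ) _
  have h2 : ∑ x, (((a μ x)ᴴ * covDeriv U μ (fun y => covShiftAdj U ν (a ν) y - a ν y) x).trace).re =
      ∑ x, (((a μ x)ᴴ * (covShiftAdj U ν (covDeriv U μ (a ν)) x - covDeriv U μ (a ν) x)).trace).re := by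
    rw [covDeriv_covDerivAdj_comm hU hflat]
  have h3 : ∑ x, (((a μ x)ᴴ * (covShiftAdj U ν (covDeriv U μ (a ν)) x - covDeriv U μ (a ν) x)).trace).re =
      ∑ x, (((covShiftAdj U ν (covDeriv U μ (a ν)) x - covDeriv U μ (a ν) x)ᴴ * a μ x).trace).re :=
    Finset.sum_congr rfl fun x _ => hsRe_symm _ _
  have h4 : ∑ x, (((covShiftAdj U ν (covDeriv U μ (a ν)) x - covDeriv U μ (a ν) x)ᴴ * a μ x).trace).re =
      ∑ x, (((covDeriv U μ (a ν) x)ᴴ * covDeriv U ν (a μ) x).trace).re :=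
    sum_hsRe_covDerivAdj hU ν (covDeriv U μ (a ν)) (a μ)
  rw [h1, h2, h3, h4]

/-- `S(div a) = Σ_μ Σ_ν Re tr((S_μ†a_μ − a_μ)ᴴ(S_ν†a_ν − a_ν))` summed over the box. [folklore] -/
theorem sum_hsS_covDiv (a : Fin 4 → FinTorusSite n₀ n₁ n₂ n₃ → Matrix (Fin N) (Fin N) ℂ) :
    ∑ x, (((covDiv U a x)ᴴ * covDiv U a x).trace).re =
      ∑ μ, ∑ ν, ∑ x, (((covShiftAdj U μ (a μ) x - a μ x)ᴴ * (covShiftAdj U ν (a ν) x - a ν x)).trace).re := by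
  have hpt : ∀ x, (((covDiv U a x)ᴴ * covDiv U a x).trace).re =
      ∑ μ, ∑ ν, (((covShiftAdj U μ (a μ) x - a μ x)ᴴ * (covShiftAdj U ν (a ν) x - a ν x)).trace).re := by
    intro x
    simp only [covDiv, Matrix.conjTranspose_sum, Finset.sum_mul, Finset.mul_sum, Matrix.trace_sum, Complex.re_sum]
    try exact Finset.sum_comm
  rw [Finset.sum_congr rfl fun x _ => hpt x, Finset.sum_comm]
  exact Finset.sum_congr rfl fun μ _ => Finset.sum_comm

/-- ★★ **The discrete Weitzenböck identity on the `Fin` box** (phase-flat unitary background `U`, any lattice 1-form `a`):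
`Σ_x Σ_μ Σ_ν S(∇⁺_μ a_ν − ∇⁺_ν a_μ)(x) + 2 Σ_x S(div a)(x) = 2 Σ_x Σ_μ Σ_ν S(∇⁺_μ a_ν)(x)` — quadratic Wilson action (all ORDERED pairs,
each unordered plaquette orientation twice) plus twice the Feynman-gauge fixing term equals twice the componentwise covariant Dirichlet
form. [folklore; García Pérez–González-Arroyo–Okawa 2017 §2.5 (Feynman gauge `P_{μν} = δ_{μν}/q̂²`); the `Fin`-box instance of
`Literature.Analysis.OperatorTheory.DiscreteWeitzenboeck.half_sum_curl_sq_add_div_sq`] -/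
theorem weitzenboeck_finBox (hU : ∀ e, U e ∈ Matrix.unitaryGroup (Fin N) ℂ) (hflat : IsPhaseFlat U)
    (a : Fin 4 → FinTorusSite n₀ n₁ n₂ n₃ → Matrix (Fin N) (Fin N) ℂ) :
    ∑ x, ∑ μ, ∑ ν, ((((covDeriv U μ (a ν) x - covDeriv U ν (a μ) x))ᴴ *
        (covDeriv U μ (a ν) x - covDeriv U ν (a μ) x)).trace).re +
      2 * ∑ x, (((covDiv U a x)ᴴ * covDiv U a x).trace).re =
      2 * ∑ x, ∑ μ, ∑ ν, (((covDeriv U μ (a ν) x)ᴴ * covDeriv U μ (a ν) x).trace).re := by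
  -- bring the site sum inside
  have hswap : ∀ F : Fin 4 → Fin 4 → FinTorusSite n₀ n₁ n₂ n₃ → ℝ,
      ∑ x, ∑ μ, ∑ ν, F μ ν x = ∑ μ, ∑ ν, ∑ x, F μ ν x := fun F => by
    rw [Finset.sum_comm]; exact Finset.sum_congr rfl fun μ _ => Finset.sum_comm
  rw [hswap, hswap, sum_hsS_covDiv]
  -- expand the squares of the curl
  have hcurl : ∀ μ ν, ∑ x, ((((covDeriv U μ (a ν) x - covDeriv U ν (a μ) x))ᴴ *
      (covDeriv U μ (a ν) x - covDeriv U ν (a μ) x)).trace).re =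
      ∑ x, (((covDeriv U μ (a ν) x)ᴴ * covDeriv U μ (a ν) x).trace).re +
        ∑ x, (((covDeriv U ν (a μ) x)ᴴ * covDeriv U ν (a μ) x).trace).re -
        2 * ∑ x, (((covShiftAdj U μ (a μ) x - a μ x)ᴴ * (covShiftAdj U ν (a ν) x - a ν x)).trace).re := by
    intro μ ν
    rw [← sum_hsRe_cross hU hflat μ ν a, Finset.mul_sum, ← Finset.sum_add_distrib, ← Finset.sum_sub_distrib]
    exact Finset.sum_congr rfl fun x _ => hsS_sub _ _
  simp only [hcurl, Finset.sum_add_distrib, Finset.sum_sub_distrib, ← Finset.mul_sum]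
  -- the second diagonal block equals the first after swapping `μ ↔ ν`
  have hdiag : ∑ μ : Fin 4, ∑ ν : Fin 4, ∑ x, (((covDeriv U ν (a μ) x)ᴴ * covDeriv U ν (a μ) x).trace).re =
      ∑ μ : Fin 4, ∑ ν : Fin 4, ∑ x, (((covDeriv U μ (a ν) x)ᴴ * covDeriv U μ (a ν) x).trace).re := Finset.sum_comm
  rw [hdiag]
  ring

/-- **Ordered pairs**: for `f` vanishing on the diagonal and symmetric, the sum over `μ < ν` (the plaquette orientations of
`wilsonFinTorusTensorTwistedPartition`) is half the full double sum. [folklore] -/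
theorem sum_pairs_lt_eq_half (f : Fin 4 → Fin 4 → ℝ) (hdiag : ∀ μ, f μ μ = 0) (hsymm : ∀ μ ν, f μ ν = f ν μ) :
    2 * ∑ q : {q : Fin 4 × Fin 4 // q.1 < q.2}, f q.1.1 q.1.2 = ∑ μ, ∑ ν, f μ ν := by
  have hlt : ∑ q : {q : Fin 4 × Fin 4 // q.1 < q.2}, f q.1.1 q.1.2 =
      ∑ q : Fin 4 × Fin 4, if q.1 < q.2 then f q.1 q.2 else 0 := by
    rw [← Finset.sum_filter]
    exact (Finset.sum_subtype _ (fun q => by simp) (fun q : Fin 4 × Fin 4 => f q.1 q.2)).symm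
  rw [hlt, Fintype.sum_prod_type]
  simp +decide only [Fin.sum_univ_four, Fin.isValue, ite_true, ite_false, hdiag, add_zero, zero_add]
  linarith [hsymm 1 0, hsymm 2 0, hsymm 3 0, hsymm 2 1, hsymm 3 1, hsymm 3 2]

/-- The curl form over ordered pairs is half the curl form over all pairs. [folklore] -/
theorem sum_hsS_curl_pairs (a : Fin 4 → FinTorusSite n₀ n₁ n₂ n₃ → Matrix (Fin N) (Fin N) ℂ) :
    2 * ∑ x, ∑ q : {q : Fin 4 × Fin 4 // q.1 < q.2}, ((((covDeriv U q.1.1 (a q.1.2) x - covDeriv U q.1.2 (a q.1.1) x))ᴴ *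
        (covDeriv U q.1.1 (a q.1.2) x - covDeriv U q.1.2 (a q.1.1) x)).trace).re =
      ∑ x, ∑ μ, ∑ ν, ((((covDeriv U μ (a ν) x - covDeriv U ν (a μ) x))ᴴ *
        (covDeriv U μ (a ν) x - covDeriv U ν (a μ) x)).trace).re := by
  rw [Finset.mul_sum]
  refine Finset.sum_congr rfl fun x _ =>
    sum_pairs_lt_eq_half (fun μ ν => ((((covDeriv U μ (a ν) x - covDeriv U ν (a μ) x))ᴴ *
      (covDeriv U μ (a ν) x - covDeriv U ν (a μ) x)).trace).re) (fun μ => ?_) (fun μ ν => ?_)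
  · simp
  · rw [← hsS_neg, neg_sub]

/-- ★★ **Coulomb-gauge transfer of a 0-form gap to 1-forms** (phase-flat unitary background).  If the componentwise covariant
Dirichlet form dominates the mass of TRACELESS site fields, `m·Σ_x S(Φ x) ≤ Σ_x Σ_μ S(∇⁺_μΦ)(x)`, then for every traceless lattice
1-form `a` on the Coulomb slice `div a = 0` the curl form alone dominates:
`m · Σ_x Σ_ν S(a_ν x) ≤ Σ_x Σ_{μ<ν} S(∇⁺_μ a_ν − ∇⁺_ν a_μ)(x)` — the tree-level Hessian of the Wilson action at the background, restricted
to the gauge slice, inherits the 0-form gap. [folklore; the `Fin`-box instance of `DiscreteWeitzenboeck.gap_of_div_eq_zero`;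
García Pérez–González-Arroyo–Okawa 2017 §2.2 («the irreducibility condition eliminates the presence of zero-modes»)] -/
theorem coulomb_gap_of_zeroForm_gap (hU : ∀ e, U e ∈ Matrix.unitaryGroup (Fin N) ℂ) (hflat : IsPhaseFlat U) {m : ℝ}
    (hgap : ∀ Φ : FinTorusSite n₀ n₁ n₂ n₃ → Matrix (Fin N) (Fin N) ℂ, (∀ x, (Φ x).trace = 0) →
      m * ∑ x, (((Φ x)ᴴ * Φ x).trace).re ≤ ∑ x, ∑ μ, (((covDeriv U μ Φ x)ᴴ * covDeriv U μ Φ x).trace).re)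
    (a : Fin 4 → FinTorusSite n₀ n₁ n₂ n₃ → Matrix (Fin N) (Fin N) ℂ) (htr : ∀ ν x, (a ν x).trace = 0)
    (hdiv : ∀ x, covDiv U a x = 0) :
    m * ∑ x, ∑ ν, (((a ν x)ᴴ * a ν x).trace).re ≤
      ∑ x, ∑ q : {q : Fin 4 × Fin 4 // q.1 < q.2}, ((((covDeriv U q.1.1 (a q.1.2) x - covDeriv U q.1.2 (a q.1.1) x))ᴴ *
        (covDeriv U q.1.1 (a q.1.2) x - covDeriv U q.1.2 (a q.1.1) x)).trace).re := by
  have hW := weitzenboeck_finBox hU hflat a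
  have hdiv' : ∑ x, (((covDiv U a x)ᴴ * covDiv U a x).trace).re = 0 :=
    Finset.sum_eq_zero fun x _ => by rw [hdiv x]; simp
  rw [hdiv', mul_zero, add_zero] at hW
  have h2 := sum_hsS_curl_pairs (U := U) a
  -- componentwise 0-form gap, summed over `ν`
  have hcomp : m * ∑ x, ∑ ν, (((a ν x)ᴴ * a ν x).trace).re ≤
      ∑ x, ∑ μ, ∑ ν, (((covDeriv U μ (a ν) x)ᴴ * covDeriv U μ (a ν) x).trace).re := by
    calc m * ∑ x, ∑ ν, (((a ν x)ᴴ * a ν x).trace).re = ∑ ν, m * ∑ x, (((a ν x)ᴴ * a ν x).trace).re := by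
          rw [Finset.sum_comm, Finset.mul_sum]
      _ ≤ ∑ ν, ∑ x, ∑ μ, (((covDeriv U μ (a ν) x)ᴴ * covDeriv U μ (a ν) x).trace).re :=
          Finset.sum_le_sum fun ν _ => hgap (a ν) (htr ν)
      _ = ∑ x, ∑ μ, ∑ ν, (((covDeriv U μ (a ν) x)ᴴ * covDeriv U μ (a ν) x).trace).re := by
          rw [Finset.sum_comm]; exact Finset.sum_congr rfl fun x _ => Finset.sum_comm
  linarith

end Weitzenboeck

/-! ## §5 The matrix-level ladder backgrounds (phase-flat unitary link fields the identity applies to) -/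

section Ladder

variable {n₀ n₁ n₂ n₃ : ℕ}

/-- **The ladder link field of a quadruple of matrices** `Γ : Fin 4 → M_N(ℂ)`: `Γ μ` on the links leaving the sheet `x_μ = 0`, the identity
elsewhere — `ladderConfig` of `…TwistedSlabGauge` read in matrices. [folklore; 't Hooft NPB 153 (1979) §3 (twist-eating transition functions)] -/
def ladderField (Γ : Fin 4 → Matrix (Fin N) (Fin N) ℂ) : FinTorusSite n₀ n₁ n₂ n₃ × Fin 4 → Matrix (Fin N) (Fin N) ℂ :=
  fun e => if finTorusSiteCoord e.1 e.2 = 0 then Γ e.2 else 1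

/-- Unfolding lemma. [folklore] -/
theorem ladderField_apply (Γ : Fin 4 → Matrix (Fin N) (Fin N) ℂ) (x : FinTorusSite n₀ n₁ n₂ n₃) (μ : Fin 4) :
    ladderField Γ (x, μ) = if finTorusSiteCoord x μ = 0 then Γ μ else 1 := rfl

/-- **`ladderField` is `ladderConfig` coerced to matrices** (`SU(N)`-valued quadruples; the same one-liner works for `U(N)`). [folklore] -/
theorem ladderField_eq_coe_ladderConfig (Γ : Fin 4 → Matrix.specialUnitaryGroup (Fin N) ℂ) :
    ladderField (n₀ := n₀) (n₁ := n₁) (n₂ := n₂) (n₃ := n₃) (fun μ => (Γ μ : Matrix (Fin N) (Fin N) ℂ)) =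
      fun e => ((ladderConfig Γ e : Matrix.specialUnitaryGroup (Fin N) ℂ) : Matrix (Fin N) (Fin N) ℂ) := by
  funext e
  unfold ladderField ladderConfig
  split_ifs <;> simp

/-- A ladder of unitaries is a unitary link field. [folklore] -/
theorem ladderField_mem_unitaryGroup {Γ : Fin 4 → Matrix (Fin N) (Fin N) ℂ} (hΓ : ∀ μ, Γ μ ∈ Matrix.unitaryGroup (Fin N) ℂ)
    (e : FinTorusSite n₀ n₁ n₂ n₃ × Fin 4) : ladderField Γ e ∈ Matrix.unitaryGroup (Fin N) ℂ := by
  unfold ladderField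
  split_ifs
  · exact hΓ _
  · exact Submonoid.one_mem _

/-- ★ **A ladder whose rungs commute up to phases is phase-flat**: if `Γ μ Γ ν = c_{μν} · Γ ν Γ μ` with `|c_{μν}| = 1`, every plaquette
of `ladderField Γ` is a phase (`c_{μν}` on the stack `x_μ = x_ν = 0`, `1` elsewhere). [folklore; 't Hooft NPB 153 (1979) §3] -/
theorem isPhaseFlat_ladderField {Γ : Fin 4 → Matrix (Fin N) (Fin N) ℂ}
    (hΓ : ∀ μ ν, ∃ c : ℂ, star c * c = 1 ∧ Γ μ * Γ ν = c • (Γ ν * Γ μ)) :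
    IsPhaseFlat (ladderField (n₀ := n₀) (n₁ := n₁) (n₂ := n₂) (n₃ := n₃) Γ) := by
  intro x μ ν
  by_cases hμν : μ = ν
  · subst hμν; exact ⟨1, by simp, by simp⟩
  obtain ⟨c, hc, hΓc⟩ := hΓ μ ν
  simp only [ladderField_apply, finTorusSiteCoord_shift_of_ne x (Ne.symm hμν), finTorusSiteCoord_shift_of_ne x hμν]
  by_cases hμ : finTorusSiteCoord x μ = 0 <;> by_cases hν : finTorusSiteCoord x ν = 0
  · exact ⟨c, hc, by simp only [hμ, hν, if_true]; exact hΓc⟩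
  · exact ⟨1, by simp, by simp [hμ, hν]⟩
  · exact ⟨1, by simp, by simp [hμ, hν]⟩
  · exact ⟨1, by simp, by simp [hμ, hν]⟩

/-- `|ω| = 1` for a root of unity in `ℂ`, in the form `star ω * ω = 1`. [folklore] -/
theorem star_mul_self_of_pow_eq_one {ω : ℂ} {n : ℕ} (hn : n ≠ 0) (hω : ω ^ n = 1) : star ω * ω = 1 := by
  have h : ‖ω‖ = 1 := Complex.norm_eq_one_of_pow_eq_one hω hn
  rw [Complex.star_def, Complex.conj_mul', h]; simp

/-- `star (ω^a) * ω^a = 1` for `star ω * ω = 1`. [folklore] -/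
theorem star_pow_mul_pow {ω : ℂ} (hω : star ω * ω = 1) (a : ℕ) : star (ω ^ a) * ω ^ a = 1 := by
  rw [star_pow, ← mul_pow, hω, one_pow]

/-- ★ **The decorated twist-eating ladder `![A, B, c₂·1, c₃·1]` is phase-flat** for a Weyl pair `AB = ω·BA` with `ω^n = 1`
(`n ≠ 0`) and any phases `c₂, c₃` (every rung pair commutes up to a phase). [folklore; 't Hooft NPB 153 (1979) §3] -/
theorem isPhaseFlat_ladderField_pair {A B : Matrix (Fin N) (Fin N) ℂ} {ω : ℂ} {n : ℕ} (hn : n ≠ 0) (hωn : ω ^ n = 1)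
    (hAB : A * B = ω • (B * A)) (c₂ c₃ : ℂ) :
    IsPhaseFlat (ladderField (n₀ := n₀) (n₁ := n₁) (n₂ := n₂) (n₃ := n₃)
      ![A, B, c₂ • (1 : Matrix (Fin N) (Fin N) ℂ), c₃ • (1 : Matrix (Fin N) (Fin N) ℂ)]) := by
  have hω := star_mul_self_of_pow_eq_one hn hωn
  have hω' : star (star ω) * star ω = 1 := by rw [star_star, mul_comm]; exact hω
  have hBA : B * A = star ω • (A * B) := by
    rw [hAB, smul_smul, hω, one_smul]
  refine isPhaseFlat_ladderField fun μ ν => ?_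
  fin_cases μ <;> fin_cases ν
  all_goals simp only [Fin.zero_eta, Fin.mk_one, Fin.reduceFinMk, Fin.isValue, Matrix.cons_val_zero, Matrix.cons_val_one,
    Matrix.cons_val]
  all_goals first
    | exact ⟨ω, hω, hAB⟩
    | exact ⟨star ω, hω', hBA⟩
    | exact ⟨1, by simp, by simp [smul_smul, mul_comm]⟩

end Ladder

end Summit.QuantumFields.YangMills.Cruxes.IRcof.TwistedSlab

end
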